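import Summits.CriticalPhenomena.SAWScalingLimit.Theses.SAWSteinDefect
import Summits.CriticalPhenomena.SAWScalingLimit.Theses.SAWLoopFugacityFlow

/-!
# `AvoidanceLimit`: the SAWSteinDefect item (stmt-CriticalPhenomena-4981) is the SAWLoopFugacityFlow crux (stmt-CriticalPhenomena-10649)

Support file for the statement item stmt-CriticalPhenomena-4981,
`Summit.CriticalPhenomena.SAWScalingLimit.Theses.SAWSteinDefect.AvoidanceLimit` (route SAWSteinDefect,
support, rank 9): for every Dobrushin domain `(D; a, b)`, hull subdomain `D'` (same marked points,
agreeing with `D` in balls around `a` and `b`), endpoint approximation `(a_δ, b_δ)`, chordal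
uniformizer `φ : ℍ → D` and restriction data `(Φ, d = Φ'_A(0))` of the pulled-back hull
`A = φ.pullbackHull D'`, the critical `δℤ²` SAW probability `P_δ(range γ_δ ⊆ closure D')` tends to
`d^(5/8)` as `δ → 0+`.

This is the rev-1 wording of the rank-2 crux of route SAWLoopFugacityFlow, whose rev-2 wording
`Summit.CriticalPhenomena.SAWScalingLimit.Theses.SAWLoopFugacityFlow.AvoidanceLimit`
(stmt-CriticalPhenomena-10649) writes the hull INLINE and quantifies it as
`∀ A, A = closure (ℍ ∖ {z ∈ ℍ | φ z ∈ D'}) → …`. Since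
`ConformalEquiv.pullbackHull φ D' = closure (ℍ ∖ {z ∈ ℍ | φ z ∈ D'})` holds by `rfl`
(`Literature.Probability.RandomPlanarGeometry.ConformalEquiv.pullbackHull`, `pullbackDomain`), the two
items are the SAME proposition: `steinDefect_iff_loopFugacityFlow` below (kernel-checked, both
directions by `intro`/`subst`). Consequences recorded for the ledger:

* stmt-CriticalPhenomena-4981 closes the moment stmt-CriticalPhenomena-10649 does
  (`steinDefect_of_loopFugacityFlow`), and conversely (`loopFugacityFlow_of_steinDefect`);
* everything the standing disprover established for the crux (no junk instance; load-bearing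
  hypotheses; exponent rigidity; `Theorems/AvoidanceLimit/Negative/*`) applies verbatim to 4981;
* mathematically both are Lawler–Schramm–Werner's restriction prediction for the planar SAW
  (LSW 2004, §4.1, Prediction 5/8-restriction law), an open problem.
-/

noncomputable section

open Set Filter Topology MeasureTheory
open UpperHalfPlane (upperHalfPlaneSet)
open Literature.Probability.RandomPlanarGeometry Literature.Probability.LatticeModels

namespace Summit.CriticalPhenomena.SAWScalingLimit.Theorems.AvoidanceLimit

/-- **The two typed forms of the 5/8 avoidance law coincide.** The SAWSteinDefect item
(stmt-CriticalPhenomena-4981, hull written `φ.pullbackHull D'`) is equivalent to the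
SAWLoopFugacityFlow crux (stmt-CriticalPhenomena-10649, hull written inline and quantified as
`∀ A, A = closure (ℍ ∖ φ⁻¹ D') → …`): `φ.pullbackHull D'` IS that closure by `rfl`, so `→` is
instantiation at `A := φ.pullbackHull D'` with `rfl`, and `←` is `subst`. [folklore] -/
theorem steinDefect_iff_loopFugacityFlow :
    Theses.SAWSteinDefect.AvoidanceLimit ↔ Theses.SAWLoopFugacityFlow.AvoidanceLimit := by
  unfold Theses.SAWSteinDefect.AvoidanceLimit Theses.SAWLoopFugacityFlow.AvoidanceLimit
  constructor
  · intro h D D' a b hab hsub h0 h1 hball φ hφ A hA Φ d hΦ hd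
    subst hA
    exact h D D' a b hab hsub h0 h1 hball φ hφ Φ d hΦ hd
  · intro h D D' a b hab hsub h0 h1 hball φ hφ Φ d hΦ hd
    exact h D D' a b hab hsub h0 h1 hball φ hφ (φ.pullbackHull D') rfl Φ d hΦ hd

/-- The SAWLoopFugacityFlow crux `AvoidanceLimit` (stmt-CriticalPhenomena-10649) implies the
SAWSteinDefect item `AvoidanceLimit` (stmt-CriticalPhenomena-4981): the closing term for 4981 once
`AvoidanceLimit_holds` is appended to the SAWLoopFugacityFlow route file. [folklore] -/
theorem steinDefect_of_loopFugacityFlow (h : Theses.SAWLoopFugacityFlow.AvoidanceLimit) :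
    Theses.SAWSteinDefect.AvoidanceLimit :=
  steinDefect_iff_loopFugacityFlow.2 h

/-- Conversely the SAWSteinDefect item (stmt-CriticalPhenomena-4981) implies the
SAWLoopFugacityFlow crux (stmt-CriticalPhenomena-10649). [folklore] -/
theorem loopFugacityFlow_of_steinDefect (h : Theses.SAWSteinDefect.AvoidanceLimit) :
    Theses.SAWLoopFugacityFlow.AvoidanceLimit :=
  steinDefect_iff_loopFugacityFlow.1 h

end Summit.CriticalPhenomena.SAWScalingLimit.Theorems.AvoidanceLimit

end
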